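/-
Copyright (c) 2026. All rights reserved.
Released under Apache 2.0 license as described in the file LICENSE.
Authors: HodgeCM publication cell (pub-hodgecm), GR lane, seat GR-1 (`pub-hodgecm-own-real34`).
-/
import Literature.NumberTheory.Automorphic.UnitaryGroupArchRealPair
import HarnessLib

/-!
# Sign patterns in `GL_ι(E ⊗ ℝ)`: elements with prescribed real-place coordinates and trivial complex coordinates

Topic `NumberTheory/Automorphic`; namespace `Literature.NumberTheory.Automorphic.UnitaryGroup`.  One definition with body
(`signPatternGL`) and theorems; no `def … : Prop`, no named fact, no `sorry`.

`E ⊗_ℚ ℝ = mixedSpace E = ℝ^{r₁} × ℂ^{r₂}` (coordinates `evalR w`, `w` real, and `evalC w`, `w` complex, of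
`UnitaryGroupArchRealPair` / `UnitaryGroupArchimedean`), so `GL_ι(E ⊗ ℝ) = ∏_{w real} GL_ι(ℝ) × ∏_{w complex} GL_ι(ℂ)`:

* §1 a matrix / an element of `GL_ι(E ⊗ ℝ)` is determined by its coordinates (`matrix_eq_of_map_eval_eq`,
  `eq_of_map_eval_eq`);
* §2 **`signPatternGL ρ ∈ GL_ι(E ⊗ ℝ)`** for `ρ : {w real} → GL_ι(ℝ)`: coordinates `ρ w` at the real places, `1` at the
  complex ones (`map_evalR_signPatternGL`, `map_evalC_signPatternGL`); it is multiplicative in `ρ` (`signPatternGL_mul`,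
  `signPatternGL_one`), and every `r` with real coordinates `ρ w` and complex coordinates `1` IS `signPatternGL ρ`
  (`eq_signPatternGL`) — e.g. the sign-pattern representatives of `GL_ι(E ⊗ ℝ)` modulo squares of
  `GeneralLinearGroupSquaresRealComplexReps` / `UnitaryGroupArchSiegelSquaresReps`;
* §3 one-place patterns `Pi.mulSingle w₀ ε` and the LIST DECOMPOSITION **`exists_list_prod_mulSingle_eq`** /
  **`exists_list_signPatternGL_mulSingle`**: a pattern with values in `{1, ε}` (`ε² = 1`) is the product, over the
  places where it is `ε`, of the one-place patterns — so `signPatternGL ρ` is a product of the elements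
  `signPatternGL (Pi.mulSingle w ε)`.

Use: the Levi sign representatives of the archimedean Siegel parabolic `P_Δ(E ⊗ ℝ)` of the doubled unitary group
(`UnitaryGroupArchSiegelLeviCayley`: `q = mA r`) as products of one-place (and two-place) sign elements — the generating
set of `DoubledWeilRepresentationArchLiftSigns.exists_isArchHalf_twist_prod_signs` ([GelbartRogawski1991, Prop. 3.1.1],
real places of `E`; [Kudla1994, §3]; [Artin1988, Chap. IV Thm. 4.7]: `GL_ι(ℝ) = ⟨squares⟩ · {1, ε}`).

## References

* E. Artin, *Geometric Algebra*, Chap. IV Thm. 4.6–4.7 [Artin1988].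
* S. S. Kudla, Israel J. Math. 87 (1994), §3 [Kudla1994].
* A. Borel, H. Jacquet, PSPM 33.1 (1979), §4.1 [BorelJacquet1979].
-/

set_option autoImplicit false

noncomputable section

open scoped Matrix MatrixGroups Classical
open NumberField NumberField.InfinitePlace NumberField.mixedEmbedding

namespace Literature.NumberTheory.Automorphic

namespace UnitaryGroup

variable (E : Type) [Field E] {ι : Type*} [Fintype ι] [DecidableEq ι]

/-! ## §1 Matrices over `E ⊗ ℝ` are determined by their coordinates -/

omit [Fintype ι] [DecidableEq ι] in
/-- a matrix over `E ⊗ ℝ = ℝ^{r₁} × ℂ^{r₂}` is determined by its real and complex coordinates. [cite: BorelJacquet1979, §4.1] -/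
theorem matrix_eq_of_map_eval_eq {M N : Matrix ι ι (mixedSpace E)}
    (hR : ∀ w : {w : InfinitePlace E // IsReal w}, M.map (evalR E w) = N.map (evalR E w))
    (hC : ∀ w : {w : InfinitePlace E // IsComplex w}, M.map (evalC E w) = N.map (evalC E w)) : M = N :=
  Matrix.ext fun i j => Prod.ext (funext fun w => congrFun (congrFun (hR w) i) j) (funext fun w => congrFun (congrFun (hC w) i) j)

/-- an element of `GL_ι(E ⊗ ℝ)` is determined by its coordinates `g_w ∈ GL_ι(ℝ)`, `GL_ι(ℂ)`. [cite: BorelJacquet1979, §4.1] -/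
theorem eq_of_map_eval_eq {g h : GL ι (mixedSpace E)}
    (hR : ∀ w : {w : InfinitePlace E // IsReal w},
      Matrix.GeneralLinearGroup.map (evalR E w) g = Matrix.GeneralLinearGroup.map (evalR E w) h)
    (hC : ∀ w : {w : InfinitePlace E // IsComplex w},
      Matrix.GeneralLinearGroup.map (evalC E w) g = Matrix.GeneralLinearGroup.map (evalC E w) h) : g = h := by
  refine Units.ext (matrix_eq_of_map_eval_eq E (fun w => ?_) (fun w => ?_))
  · exact congrArg (fun x : GL ι ℝ => (x : Matrix ι ι ℝ)) (hR w)
  · exact congrArg (fun x : GL ι ℂ => (x : Matrix ι ι ℂ)) (hC w)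

/-! ## §2 The element of `GL_ι(E ⊗ ℝ)` with prescribed real coordinates and trivial complex coordinates -/

/-- the matrix with real coordinates `ρ w` and complex coordinates `1`. [cite: Artin1988, Chap. IV Thm. 4.7] -/
def signPatternMat (ρ : {w : InfinitePlace E // IsReal w} → GL ι ℝ) : Matrix ι ι (mixedSpace E) :=
  Matrix.of fun i j => (fun w => ((ρ w : GL ι ℝ) : Matrix ι ι ℝ) i j, fun _ => (1 : Matrix ι ι ℂ) i j)

/-- real coordinates. [cite: Artin1988, Chap. IV Thm. 4.7] -/
@[simp] theorem map_evalR_signPatternMat (ρ : {w : InfinitePlace E // IsReal w} → GL ι ℝ) (w : {w : InfinitePlace E // IsReal w}) :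
    (signPatternMat E ρ).map (evalR E w) = ((ρ w : GL ι ℝ) : Matrix ι ι ℝ) := rfl

/-- complex coordinates. [cite: Artin1988, Chap. IV Thm. 4.7] -/
@[simp] theorem map_evalC_signPatternMat (ρ : {w : InfinitePlace E // IsReal w} → GL ι ℝ) (w : {w : InfinitePlace E // IsComplex w}) :
    (signPatternMat E ρ).map (evalC E w) = 1 := rfl

/-- its determinant is a unit (coordinates `det ρ w` and `1`). [cite: Artin1988, Chap. IV Thm. 4.7] -/
theorem isUnit_det_signPatternMat (ρ : {w : InfinitePlace E // IsReal w} → GL ι ℝ) : IsUnit (signPatternMat E ρ).det := by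
  rw [Prod.isUnit_iff, Pi.isUnit_iff, Pi.isUnit_iff]
  refine ⟨fun w => ?_, fun w => ?_⟩
  · have h : (signPatternMat E ρ).det.1 w = ((signPatternMat E ρ).map (evalR E w)).det := by
      rw [← evalR_apply, RingHom.map_det, RingHom.mapMatrix_apply]
    rw [h, map_evalR_signPatternMat]
    exact Matrix.isUnits_det_units (ρ w)
  · have h : (signPatternMat E ρ).det.2 w = ((signPatternMat E ρ).map (evalC E w)).det := by
      rw [← evalC_apply, RingHom.map_det, RingHom.mapMatrix_apply]
    rw [h, map_evalC_signPatternMat, Matrix.det_one]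
    exact isUnit_one

/-- **`signPatternGL ρ ∈ GL_ι(E ⊗ ℝ)`**: the element with real coordinates `ρ w ∈ GL_ι(ℝ)` and complex coordinates `1`.
[cite: Artin1988, Chap. IV Thm. 4.7] -/
def signPatternGL (ρ : {w : InfinitePlace E // IsReal w} → GL ι ℝ) : GL ι (mixedSpace E) :=
  Matrix.GeneralLinearGroup.mk'' (signPatternMat E ρ) (isUnit_det_signPatternMat E ρ)

/-- underlying matrix. [cite: Artin1988, Chap. IV Thm. 4.7] -/
@[simp] theorem coe_signPatternGL (ρ : {w : InfinitePlace E // IsReal w} → GL ι ℝ) :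
    ((signPatternGL E ρ : GL ι (mixedSpace E)) : Matrix ι ι (mixedSpace E)) = signPatternMat E ρ := rfl

/-- **real coordinates: `(signPatternGL ρ)_w = ρ w`.** [cite: Artin1988, Chap. IV Thm. 4.7] -/
@[simp] theorem map_evalR_signPatternGL (ρ : {w : InfinitePlace E // IsReal w} → GL ι ℝ) (w : {w : InfinitePlace E // IsReal w}) :
    Matrix.GeneralLinearGroup.map (evalR E w) (signPatternGL E ρ) = ρ w :=
  Units.ext (map_evalR_signPatternMat E ρ w)

/-- **complex coordinates: `(signPatternGL ρ)_w = 1`.** [cite: Artin1988, Chap. IV Thm. 4.7] -/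
@[simp] theorem map_evalC_signPatternGL (ρ : {w : InfinitePlace E // IsReal w} → GL ι ℝ) (w : {w : InfinitePlace E // IsComplex w}) :
    Matrix.GeneralLinearGroup.map (evalC E w) (signPatternGL E ρ) = 1 :=
  Units.ext ((map_evalC_signPatternMat E ρ w).trans (by simp))

/-- **an element of `GL_ι(E ⊗ ℝ)` with real coordinates `ρ w` and trivial complex coordinates is `signPatternGL ρ`.**
[cite: Artin1988, Chap. IV Thm. 4.7] -/
theorem eq_signPatternGL (r : GL ι (mixedSpace E)) (ρ : {w : InfinitePlace E // IsReal w} → GL ι ℝ)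
    (hR : ∀ w, Matrix.GeneralLinearGroup.map (evalR E w) r = ρ w)
    (hC : ∀ w, Matrix.GeneralLinearGroup.map (evalC E w) r = 1) : r = signPatternGL E ρ :=
  eq_of_map_eval_eq E (fun w => by rw [hR, map_evalR_signPatternGL]) (fun w => by rw [hC, map_evalC_signPatternGL])

/-- **multiplicativity**: `signPatternGL (ρ ρ') = signPatternGL ρ · signPatternGL ρ'`. [cite: Artin1988, Chap. IV Thm. 4.7] -/
theorem signPatternGL_mul (ρ ρ' : {w : InfinitePlace E // IsReal w} → GL ι ℝ) :
    signPatternGL E (ρ * ρ') = signPatternGL E ρ * signPatternGL E ρ' :=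
  eq_of_map_eval_eq E (fun w => by rw [map_mul, map_evalR_signPatternGL, map_evalR_signPatternGL, map_evalR_signPatternGL, Pi.mul_apply])
    (fun w => by rw [map_mul, map_evalC_signPatternGL, map_evalC_signPatternGL, map_evalC_signPatternGL, mul_one])

/-- `signPatternGL 1 = 1`. [cite: Artin1988, Chap. IV Thm. 4.7] -/
@[simp] theorem signPatternGL_one : signPatternGL E (1 : {w : InfinitePlace E // IsReal w} → GL ι ℝ) = 1 :=
  eq_of_map_eval_eq E (fun w => by rw [map_evalR_signPatternGL, map_one, Pi.one_apply])
    (fun w => by rw [map_evalC_signPatternGL, map_one])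

/-- **`signPatternGL` as a homomorphism `(∏_{w real} GL_ι(ℝ)) →* GL_ι(E ⊗ ℝ)`.** [cite: Artin1988, Chap. IV Thm. 4.7] -/
def signPatternHom : ({w : InfinitePlace E // IsReal w} → GL ι ℝ) →* GL ι (mixedSpace E) where
  toFun := signPatternGL E
  map_one' := signPatternGL_one E
  map_mul' := signPatternGL_mul E

/-- unfolding. [cite: Artin1988, Chap. IV Thm. 4.7] -/
@[simp] theorem signPatternHom_apply (ρ : {w : InfinitePlace E // IsReal w} → GL ι ℝ) :
    signPatternHom E ρ = signPatternGL E ρ := rfl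

/-- a product of sign-pattern elements is the sign-pattern element of the product. [cite: Artin1988, Chap. IV Thm. 4.7] -/
theorem prod_map_signPatternGL (l : List ({w : InfinitePlace E // IsReal w} → GL ι ℝ)) :
    (l.map (signPatternGL E)).prod = signPatternGL E l.prod := by
  show (l.map (signPatternHom E)).prod = signPatternHom E l.prod
  exact (map_list_prod (signPatternHom E) l).symm

/-! ## §3 One-place patterns and the list decomposition of a `{1, ε}`-valued pattern -/

section Decomposition

variable {G : Type*} [Group G] {α : Type*} [DecidableEq α]

omit [Fintype ι] [DecidableEq ι] in
/-- the product of the one-place patterns `mulSingle w ε` over a duplicate-free list `l` is `ε` on `l` and `1` off `l`.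
[cite: Artin1988, Chap. IV Thm. 4.7] -/
theorem prod_map_mulSingle_apply (ε : G) (l : List α) (hl : l.Nodup) (w : α) :
    (l.map fun a => (Pi.mulSingle a ε : α → G)).prod w = if w ∈ l then ε else 1 := by
  induction l with
  | nil => simp
  | cons a l ih =>
    have ha : a ∉ l := (List.nodup_cons.1 hl).1
    rw [List.map_cons, List.prod_cons, Pi.mul_apply, ih (List.nodup_cons.1 hl).2, Pi.mulSingle_apply]
    by_cases hw : w = a
    · subst hw
      simp [ha]
    · simp [hw]

omit [Fintype ι] [DecidableEq ι] in
/-- **list decomposition of a `{1, ε}`-valued pattern**: for `ρ : α → G` (`α` finite) with `ρ a ∈ {1, ε}` for all `a`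
there is a duplicate-free list `l` (the places where `ρ = ε`, `ε ≠ 1`) with `ρ = ∏_{a ∈ l} mulSingle a ε`.
[cite: Artin1988, Chap. IV Thm. 4.7] -/
theorem exists_list_prod_mulSingle_eq [Fintype α] (ε : G) (hε : ε ≠ 1) (ρ : α → G) (hρ : ∀ a, ρ a = 1 ∨ ρ a = ε) :
    ∃ l : List α, l.Nodup ∧ (∀ a, a ∈ l ↔ ρ a = ε) ∧ (l.map fun a => (Pi.mulSingle a ε : α → G)).prod = ρ := by
  classical
  refine ⟨(Finset.univ.filter fun a => ρ a = ε).toList, Finset.nodup_toList _, fun a => by simp, ?_⟩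
  funext w
  rw [prod_map_mulSingle_apply ε _ (Finset.nodup_toList _) w]
  simp only [Finset.mem_toList, Finset.mem_filter, Finset.mem_univ, true_and]
  rcases hρ w with h | h
  · rw [if_neg (by rw [h]; exact hε.symm), h]
  · rw [if_pos h, h]

/-- **`signPatternGL ρ` for a `{1, ε}`-valued `ρ` is a product of one-place sign elements**
`signPatternGL (mulSingle w ε)` over the real places `w` with `ρ w = ε`. [cite: Artin1988, Chap. IV Thm. 4.7] -/
theorem exists_list_signPatternGL_mulSingle [NumberField E] (ε : GL ι ℝ) (hε : ε ≠ 1)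
    (ρ : {w : InfinitePlace E // IsReal w} → GL ι ℝ) (hρ : ∀ w, ρ w = 1 ∨ ρ w = ε) :
    ∃ l : List {w : InfinitePlace E // IsReal w}, l.Nodup ∧ (∀ w, w ∈ l ↔ ρ w = ε) ∧
      (l.map fun w => signPatternGL E (Pi.mulSingle w ε)).prod = signPatternGL E ρ := by
  obtain ⟨l, hl, hmem, hprod⟩ := exists_list_prod_mulSingle_eq ε hε ρ hρ
  refine ⟨l, hl, hmem, ?_⟩
  rw [← hprod, ← prod_map_signPatternGL, List.map_map]
  rfl

end Decomposition

/-! ## §4 Coordinates of one-place and two-place sign elements -/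

/-- the real coordinates of `signPatternGL (mulSingle w₀ ε)`: `ε` at `w₀`, `1` elsewhere. [cite: Artin1988, Chap. IV Thm. 4.7] -/
theorem map_evalR_signPatternGL_mulSingle (ε : GL ι ℝ) (w₀ w : {w : InfinitePlace E // IsReal w}) :
    Matrix.GeneralLinearGroup.map (evalR E w) (signPatternGL E (Pi.mulSingle w₀ ε)) = if w = w₀ then ε else 1 := by
  rw [map_evalR_signPatternGL, Pi.mulSingle_apply]

/-- `signPatternGL (mulSingle w ε)² = 1` when `ε² = 1`. [cite: Artin1988, Chap. IV Thm. 4.7] -/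
theorem signPatternGL_mulSingle_mul_self (ε : GL ι ℝ) (hε : ε * ε = 1) (w₀ : {w : InfinitePlace E // IsReal w}) :
    signPatternGL E (Pi.mulSingle w₀ ε) * signPatternGL E (Pi.mulSingle w₀ ε) = 1 := by
  rw [← signPatternGL_mul, ← Pi.mulSingle_mul, hε, Pi.mulSingle_one, signPatternGL_one]

/-- one-place sign elements commute. [cite: Artin1988, Chap. IV Thm. 4.7] -/
theorem signPatternGL_mulSingle_comm (ε : GL ι ℝ) (w₁ w₂ : {w : InfinitePlace E // IsReal w}) :
    signPatternGL E (Pi.mulSingle w₁ ε) * signPatternGL E (Pi.mulSingle w₂ ε) =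
      signPatternGL E (Pi.mulSingle w₂ ε) * signPatternGL E (Pi.mulSingle w₁ ε) := by
  by_cases h : w₁ = w₂
  · rw [h]
  · rw [← signPatternGL_mul, ← signPatternGL_mul,
      (Pi.mulSingle_commute (f := fun _ : {w : InfinitePlace E // IsReal w} => GL ι ℝ) h ε ε).eq]
  
end UnitaryGroup

end Literature.NumberTheory.Automorphic

end
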